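import Literature.AlgebraicGeometry.Resolution.NeronPopescuSteps
import Mathlib.RingTheory.Smooth.Basic
import Mathlib.RingTheory.Smooth.Locus
import Mathlib.RingTheory.FinitePresentation
import Mathlib.RingTheory.Localization.Away.Basic
import Mathlib.RingTheory.Localization.Away.AdjoinRoot
import Mathlib.RingTheory.MvPolynomial.Tower
import Mathlib.Algebra.MvPolynomial.Degrees
import HarnessLib

/-!
# Local tricks (Stacks, Smoothing Ring Maps, §07F6: Lemmas 07F9, 07FA) for a local base

Topic: `Literature/AlgebraicGeometry/Resolution`. Support file of the INLINE proof of the named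
fact `Stacks07FE_resolveSpecial` (`NeronPopescuSteps.lean`). In the printed proof of 07FE,
after Lemma 07F8 one must resolve the Artinian situation
`R/(x^e) → C/(x^e) → Λ/(π^e) ⊃ 𝔮/(π^e)`; "By Lemma 07FA, it suffices to resolve … after
localizing at 𝔮", and Lemma 07FA rests on Lemma 07F9. This file PROVES both lemmas
(sorry-free, no named facts) in the form needed there, i.e. over a base ring which is already
local (`R = R_𝔭`, so that the elements `s_0, s_j ∉ 𝔭` of the printed proof of 07F9 are `1`)
and with the local resolution `R_𝔭 → A_𝔭 → Λ_𝔮 ⊃ 𝔮Λ_𝔮` given in the (stronger, and by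
Lemmas 16.2.8, 07CH equivalent) form "`A → Λ → Λ_𝔮` factors through a smooth algebra", which is
what Proposition 07CM (`NeronPopescuLiftingProblem.lean`) supplies:

* `Stacks07F9_local_exists_factorization` — **Lemma 07F9**: from `A → C → Λ_𝔮` with `C` smooth,
  a factorisation `A → B → Λ` with `B` finitely presented and `H_{B/R}Λ ⊄ 𝔮` (an element
  `b ∈ B` with `B_b` smooth and `b ↦ Λ ∖ 𝔮`). Printed construction (`B = A[x_0, x, y]/(x_0 F_j)`
  with the forms `F_j = y^{deg} f_j(x/y)`, `b = x_0 y`), presenting `C` over `A` so that the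
  relations of `A` need no separate treatment; the isomorphism `B_b ≅ C[x_0, y, 1/x_0y]` of the
  printed proof is replaced by the retraction `C[x_0, y, 1/x_0 y] → B_b` (a retract of a
  formally smooth algebra is formally smooth, `formallySmooth_of_retract`).
* `Stacks07FA_canResolve_of_factorization` — **Lemma 07FA** (given the output of 07F9): with
  `𝔥_A ⊆ 𝔮` and `dim Λ_𝔮 = 0`, `R → A → Λ ⊃ 𝔮` can be resolved
  (`CanResolve`, `NeronPopescuSingularIdeal.lean`), by the printed gadget
  `B = A[x, y_i, z, t_{ij}]/(f_j - Σ y_i t_{ij}, z y_i)`; again the two printed isomorphisms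
  `B_z ≅ C[t, z^{±1}]`, `B_{y_ℓ} ≅ A[x, y, t', y_ℓ⁻¹]` are replaced by retractions.
* `canResolve_of_smooth_local_factorization_of_krullDimLE_zero` — 07F9 + 07FA combined.
* Tools: `formallySmooth_of_retract`, `smooth_away_of_retract`,
  `exists_mul_pow_eq_zero_of_krullDimLE_zero`; the total-degree homogenisation
  `F(y·x', y) = y^N f(x')` is a local definition inside the proof of 07F9.

## Sources

* The Stacks Project, *Smoothing Ring Maps* (Tag 07BW), Section 07F6 "Local tricks":
  Situation 07F7, Lemma 07F9, Lemma 07FA, with their proofs; proof of Lemma 07FE.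
  [StacksProject]
-/

noncomputable section

namespace Literature.AlgebraicGeometry.Resolution

universe u v

open MvPolynomial

/-! ## Retracts of formally smooth algebras -/

section Tools

variable {A : Type*} [CommRing A] {m : ℕ}

/-- A retract of a formally smooth algebra is formally smooth. [folklore] -/
theorem formallySmooth_of_retract {R : Type u} [CommRing R] {B T : Type u} [CommRing B]
    [Algebra R B] [CommRing T] [Algebra R T] [Algebra.FormallySmooth R T] (Φ : B →ₐ[R] T)
    (Ψ : T →ₐ[R] B) (h : Ψ.comp Φ = AlgHom.id R B) : Algebra.FormallySmooth R B := by
  refine Algebra.FormallySmooth.of_comp_surjective fun D _ _ I hI g => ?_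
  obtain ⟨G, hG⟩ := Algebra.FormallySmooth.comp_surjective R T I hI (g.comp Ψ)
  exact ⟨G.comp Φ, by rw [← AlgHom.comp_assoc, hG, AlgHom.comp_assoc, h, AlgHom.comp_id]⟩

end Tools

/-! ## Stacks 07F9 over a local base: spreading out a local smooth factorisation -/

section Stacks07F9

variable {R : Type u} [CommRing R] {A : Type u} [CommRing A] [Algebra R A]
  {Λ : Type u} [CommRing Λ] [Algebra R Λ]

/-- **Stacks, Lemma 07F9**, for a local base ring (`R = R_𝔭`) and with the local resolution
given in smooth form: let `A` be finitely presented over `R`, `φ : A → Λ`, `𝔮 ⊂ Λ` a prime,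
and suppose `A → Λ → Λ_𝔮` factors as `A → C → Λ_𝔮` with `C` smooth over `R`. Then `φ`
factors as `A → B → Λ` with `B` finitely presented over `R` and `H_{B/R}Λ ⊄ 𝔮`, i.e. some
`b ∈ B` with `B_b` smooth over `R` maps outside `𝔮`. Printed proof (with `s_0 = s_j = 1`,
and presenting `C` over `A` so that the relations of `A` need no separate treatment): write
`C = A[x_1, …, x_m]/(f_1, …, f_c)`, `x_i ↦ λ_i/λ` in `Λ_𝔮` with a common denominator
`λ ∉ 𝔮`; the forms `F_j(x, y) = y^{deg f_j} f_j(x/y)` satisfy `λ_0 F_j(λ, λ) = 0` in `Λ` for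
some `λ_0 ∉ 𝔮`; set `B = A[x_0, x_1, …, x_m, y]/(x_0 F_j)` mapping to `Λ` by `x_i ↦ λ_i`,
`y ↦ λ`, `x_0 ↦ λ_0`, and `b = x_0 y`; then `B_b ≅ C[x_0, y, 1/x_0y]` is smooth (here: `B_b` is a
retract of the smooth algebra `C[x_0, y, 1/x_0y]`, which suffices for formal smoothness).
[cite: StacksProject, Tag 07F9] -/
theorem Stacks07F9_local_exists_factorization [Algebra.FinitePresentation R A] (φ : A →ₐ[R] Λ)
    (q : Ideal Λ) [q.IsPrime] (C : Type u) [CommRing C] [Algebra R C] [Algebra.Smooth R C]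
    (u : A →ₐ[R] C) (v : C →ₐ[R] Localization.AtPrime q)
    (huv : ∀ a, v (u a) = algebraMap Λ (Localization.AtPrime q) (φ a)) :
    ∃ (B : Type u) (_ : CommRing B) (_ : Algebra R B), Algebra.FinitePresentation R B ∧
      ∃ (α : A →ₐ[R] B) (β : B →ₐ[R] Λ), β.comp α = φ ∧
        ∃ b : B, β b ∉ q ∧ Algebra.Smooth R (Localization.Away b) := by
  classical
  -- total-degree homogenisation `F(x, y) = Σ_α a_α x^α y^{N-|α|}` and its defining identity
  -- `F(y·x', y) = y^N f(x')`
  let homog : ∀ {m : ℕ}, MvPolynomial (Fin m) A → ℕ → MvPolynomial (Fin m ⊕ Unit) A :=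
    fun {m} f N => ∑ α ∈ f.support,
      MvPolynomial.C (coeff α f) * (∏ i, X (Sum.inl i) ^ α i) * X (Sum.inr ()) ^ (N - ∑ i, α i)
  have aeval_homog_smul : ∀ {m : ℕ} {T : Type u} [CommRing T] [Algebra A T]
      (f : MvPolynomial (Fin m) A) {N : ℕ}, f.totalDegree ≤ N → ∀ (x' : Fin m → T) (y : T),
      aeval (Sum.elim (fun i => y * x' i) (fun _ => y)) (homog f N) = y ^ N * aeval x' f := by
    intro m T _ _ f N hN x' y
    have hdeg : ∀ α ∈ f.support, ∑ i, α i ≤ N := fun α hα => by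
      have h := MvPolynomial.le_totalDegree hα
      rw [Finsupp.sum_fintype _ _ (fun _ => rfl)] at h
      exact h.trans hN
    rw [MvPolynomial.aeval_def (f := x'), MvPolynomial.eval₂_eq', Finset.mul_sum]
    simp only [homog, map_sum, map_mul, map_prod, map_pow, MvPolynomial.aeval_C,
      MvPolynomial.aeval_X, Sum.elim_inl, Sum.elim_inr]
    refine Finset.sum_congr rfl fun α hα => ?_
    simp_rw [mul_pow]
    rw [Finset.prod_mul_distrib, Finset.prod_pow_eq_pow_sum]
    have hy : y ^ (∑ i, α i) * y ^ (N - ∑ i, α i) = y ^ N := by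
      rw [← pow_add, Nat.add_sub_cancel' (hdeg α hα)]
    calc _ = algebraMap A T (coeff α f) * (∏ i, x' i ^ α i) *
          (y ^ (∑ i, α i) * y ^ (N - ∑ i, α i)) := by ring
      _ = y ^ N * (algebraMap A T (coeff α f) * ∏ i, x' i ^ α i) := by rw [hy]; ring
  set Λq := Localization.AtPrime q with hΛq
  -- `C` is finitely presented over `A` (through `u`): `C = A[x_1, …, x_n]/(f : f ∈ sK)`
  letI : Algebra A C := u.toRingHom.toAlgebra
  haveI : IsScalarTower R A C := IsScalarTower.of_algebraMap_eq fun r => (u.commutes r).symm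
  haveI : Algebra.FinitePresentation A C :=
    Algebra.FinitePresentation.of_restrict_scalars_finitePresentation R A C
  obtain ⟨n, π, hπ, hkfg⟩ := Algebra.FinitePresentation.out (R := A) (A := C)
  obtain ⟨sK, hsK⟩ := hkfg
  have hmemK : ∀ f ∈ sK, π f = 0 := fun f hf => by
    have : f ∈ RingHom.ker π.toRingHom := hsK ▸ Ideal.subset_span hf
    exact this
  -- `Λ`, `Λ_𝔮` as `A`-algebras
  letI : Algebra A Λ := φ.toRingHom.toAlgebra
  have halgAΛ : ∀ a, algebraMap A Λ a = φ a := fun a => rfl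
  haveI : IsScalarTower R A Λ := IsScalarTower.of_algebraMap_eq fun r => (φ.commutes r).symm
  have halgAq : ∀ a, algebraMap A Λq a = algebraMap Λ Λq (φ a) := fun a =>
    IsScalarTower.algebraMap_apply A Λ Λq a
  have hvA : ∀ a, v (algebraMap A C a) = algebraMap A Λq a := fun a => by
    rw [halgAq]
    exact huv a
  let vA : C →ₐ[A] Λq := { toRingHom := v.toRingHom, commutes' := hvA }
  have hvA' : ∀ c, vA c = v c := fun c => rfl
  -- a common denominator `g ∉ 𝔮`: `v(π x_i) · g = λ_i`
  have hfrac : ∀ i : Fin n, ∃ (l : Λ) (s : q.primeCompl),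
      v (π (X i)) * algebraMap Λ Λq s = algebraMap Λ Λq l := fun i => by
    obtain ⟨⟨l, s⟩, h⟩ := IsLocalization.surj q.primeCompl (v (π (X i)))
    exact ⟨l, s, h⟩
  choose l s hls using hfrac
  let g : Λ := ∏ i, (s i : Λ)
  have hg : g ∈ q.primeCompl := prod_mem fun i _ => (s i).2
  let lam : Fin n → Λ := fun i => l i * ∏ j ∈ Finset.univ.erase i, (s j : Λ)
  have hlam : ∀ i, algebraMap Λ Λq (lam i) = algebraMap Λ Λq g * v (π (X i)) := fun i => by
    have hgi : g = (∏ j ∈ Finset.univ.erase i, (s j : Λ)) * (s i : Λ) :=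
      (Finset.prod_erase_mul _ _ (Finset.mem_univ i)).symm
    simp only [lam]
    rw [hgi, map_mul, map_mul, mul_assoc, mul_comm (algebraMap Λ Λq (s i : Λ)) (v (π (X i))),
      hls i]
    exact mul_comm _ _
  -- the forms `F_f = homog f`, evaluated at `(λ, g)`, die in `Λ_𝔮`
  let w : Fin n ⊕ Unit → Λ := Sum.elim lam (fun _ => g)
  have haevalπ : (aeval fun i => v (π (X i)) : MvPolynomial (Fin n) A →ₐ[A] Λq) = vA.comp π := by
    apply MvPolynomial.algHom_ext
    intro i
    rw [aeval_X, AlgHom.comp_apply, hvA']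
  have hrelq : ∀ f ∈ sK, algebraMap Λ Λq (aeval w (homog f f.totalDegree)) = 0 := by
    intro f hf
    rw [← MvPolynomial.aeval_algebraMap_apply]
    have hw : (algebraMap Λ Λq ∘ w) = Sum.elim (fun i => algebraMap Λ Λq g * v (π (X i)))
        (fun _ => algebraMap Λ Λq g) := by
      funext x
      rcases x with i | _
      · exact hlam i
      · rfl
    rw [hw, aeval_homog_smul f le_rfl, haevalπ, AlgHom.comp_apply, hmemK f hf, map_zero,
      mul_zero]
  have hkill : ∀ f ∈ sK, ∃ t : q.primeCompl, (t : Λ) * aeval w (homog f f.totalDegree) = 0 :=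
    fun f hf => (IsLocalization.map_eq_zero_iff q.primeCompl Λq _).mp (hrelq f hf)
  choose! t ht using hkill
  let lam0 : Λ := ∏ f ∈ sK, (t f : Λ)
  have hlam0 : lam0 ∈ q.primeCompl := prod_mem fun f hf => (t f).2
  have hkill' : ∀ f ∈ sK, lam0 * aeval w (homog f f.totalDegree) = 0 := fun f hf => by
    obtain ⟨rest, hrest⟩ : (t f : Λ) ∣ lam0 := Finset.dvd_prod_of_mem _ hf
    rw [hrest, mul_comm (t f : Λ), mul_assoc, ht f hf, mul_zero]
  -- `B = A[x_0, x, y]/(x_0 F_f : f ∈ sK)`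
  let V := (Fin n ⊕ Unit) ⊕ Unit
  let rel : MvPolynomial (Fin n) A → MvPolynomial V A := fun f =>
    X (Sum.inr ()) * rename Sum.inl (homog f f.totalDegree)
  let 𝔟 : Ideal (MvPolynomial V A) := Ideal.span (rel '' sK)
  have h𝔟fg : 𝔟.FG := ⟨sK.image rel, by rw [Finset.coe_image]⟩
  let B := MvPolynomial V A ⧸ 𝔟
  haveI : Algebra.FinitePresentation R (MvPolynomial V A) := .trans R A _
  have hB : Algebra.FinitePresentation R B :=
    Algebra.FinitePresentation.quotient h𝔟fg
  -- `β : B → Λ`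
  let wB : V → Λ := Sum.elim w (fun _ => lam0)
  let β₀ : MvPolynomial V A →ₐ[A] Λ := aeval wB
  have hβ₀rel : ∀ f ∈ sK, β₀ (rel f) = 0 := fun f hf => by
    simp only [β₀, rel, map_mul, aeval_X, aeval_rename]
    exact hkill' f hf
  have h𝔟β₀ : ∀ x ∈ 𝔟, β₀ x = 0 := by
    intro x hx
    rw [← RingHom.mem_ker]
    refine (Ideal.span_le.mpr ?_) hx
    rintro _ ⟨f, hf, rfl⟩
    exact hβ₀rel f hf
  let βA : B →ₐ[A] Λ := Ideal.Quotient.liftₐ 𝔟 β₀ h𝔟β₀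
  have hβA : ∀ p, βA (Ideal.Quotient.mk 𝔟 p) = β₀ p := fun p => rfl
  let β : B →ₐ[R] Λ := βA.restrictScalars R
  let α : A →ₐ[R] B := IsScalarTower.toAlgHom R A B
  have hβα : β.comp α = φ := by
    apply AlgHom.ext
    intro a
    change βA (algebraMap A _ a) = φ a
    rw [βA.commutes]
    rfl
  -- `b = x_0 y ↦ λ_0 g ∉ 𝔮`
  let bP : MvPolynomial V A := X (Sum.inr ()) * X (Sum.inl (Sum.inr ()))
  let b : B := Ideal.Quotient.mk 𝔟 bP
  have hβb : β b = lam0 * g := by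
    change βA (Ideal.Quotient.mk 𝔟 bP) = _
    rw [hβA]
    simp only [β₀, bP, map_mul, aeval_X, wB, w, Sum.elim_inr, Sum.elim_inl]
  have hβbq : β b ∉ q := by
    rw [hβb]
    exact q.primeCompl.mul_mem hlam0 hg
  suffices hsm : Algebra.Smooth R (Localization.Away b) from
    ⟨B, inferInstance, inferInstance, hB, α, β, hβα, b, hβbq, hsm⟩
  -- `B_b` is a retract of the smooth algebra `T = C[y, x_0][1/(y x_0)]`
  let P2 := MvPolynomial (Unit ⊕ Unit) C
  let tP : P2 := X (Sum.inl ()) * X (Sum.inr ())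
  let T := Localization.Away tP
  haveI : Algebra.Smooth C P2 := ⟨inferInstance, inferInstance⟩
  haveI : Algebra.Smooth R P2 := Algebra.Smooth.comp R C P2
  haveI : Algebra.Smooth P2 T := Algebra.Smooth.of_isLocalization_Away tP
  haveI : Algebra.Smooth R T := Algebra.Smooth.comp R P2 T
  let Bb := Localization.Away b
  -- `Φ : B_b → T`
  let cT : Fin n → T := fun i => algebraMap C T (π (X i))
  let yT : T := algebraMap P2 T (X (Sum.inl ()))
  let x0T : T := algebraMap P2 T (X (Sum.inr ()))
  let wT : V → T := Sum.elim (Sum.elim (fun i => yT * cT i) (fun _ => yT)) (fun _ => x0T)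
  let Φ₀ : MvPolynomial V A →ₐ[A] T := aeval wT
  have haevalπT : (aeval cT : MvPolynomial (Fin n) A →ₐ[A] T) =
      (IsScalarTower.toAlgHom A C T).comp π := by
    apply MvPolynomial.algHom_ext
    intro i
    rw [aeval_X, AlgHom.comp_apply]
    rfl
  have hΦ₀rel : ∀ f ∈ sK, Φ₀ (rel f) = 0 := fun f hf => by
    simp only [Φ₀, rel, map_mul, aeval_X, aeval_rename]
    have hcomp : (wT ∘ Sum.inl) = Sum.elim (fun i => yT * cT i) (fun _ => yT) := rfl
    rw [hcomp, aeval_homog_smul f le_rfl, haevalπT, AlgHom.comp_apply, hmemK f hf, map_zero,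
      mul_zero, mul_zero]
  have h𝔟Φ₀ : ∀ x ∈ 𝔟, Φ₀ x = 0 := by
    intro x hx
    rw [← RingHom.mem_ker]
    refine (Ideal.span_le.mpr ?_) hx
    rintro _ ⟨f, hf, rfl⟩
    exact hΦ₀rel f hf
  let Φ₁ : B →ₐ[A] T := Ideal.Quotient.liftₐ 𝔟 Φ₀ h𝔟Φ₀
  have hΦ₁ : ∀ p, Φ₁ (Ideal.Quotient.mk 𝔟 p) = Φ₀ p := fun p => rfl
  have hΦ₁b : Φ₁ b = x0T * yT := by
    change Φ₁ (Ideal.Quotient.mk 𝔟 bP) = _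
    rw [hΦ₁]
    simp only [Φ₀, bP, map_mul, aeval_X, wT, Sum.elim_inr, Sum.elim_inl]
  have hunitT : IsUnit (x0T * yT) := by
    have : x0T * yT = algebraMap P2 T tP := by
      simp only [x0T, yT, tP, map_mul]
      exact mul_comm _ _
    rw [this]
    exact IsLocalization.Away.algebraMap_isUnit tP
  have hΦ₁u : ∀ y : Submonoid.powers b, IsUnit (Φ₁ y) := by
    rintro ⟨y, k, rfl⟩
    rw [map_pow, hΦ₁b]
    exact hunitT.pow k
  let Φ : Bb →ₐ[A] T := IsLocalization.liftAlgHom hΦ₁u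
  have hΦ : ∀ x : B, Φ (algebraMap B Bb x) = Φ₁ x := fun x => IsLocalization.lift_eq hΦ₁u x
  -- `Ψ : T → B_b`
  let xB : Fin n → Bb := fun i => algebraMap B Bb (Ideal.Quotient.mk 𝔟 (X (Sum.inl (Sum.inl i))))
  let yB : Bb := algebraMap B Bb (Ideal.Quotient.mk 𝔟 (X (Sum.inl (Sum.inr ()))))
  let x0B : Bb := algebraMap B Bb (Ideal.Quotient.mk 𝔟 (X (Sum.inr ())))
  have hbunit : IsUnit (algebraMap B Bb b) := IsLocalization.Away.algebraMap_isUnit b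
  have hbB : algebraMap B Bb b = x0B * yB := by
    change algebraMap B Bb (Ideal.Quotient.mk 𝔟 (X (Sum.inr ()) * X (Sum.inl (Sum.inr ())))) = _
    rw [map_mul, map_mul]
  have hyBu : IsUnit yB := isUnit_of_mul_isUnit_right (hbB ▸ hbunit)
  have hx0Bu : IsUnit x0B := isUnit_of_mul_isUnit_left (hbB ▸ hbunit)
  let yBi : Bb := ((hyBu.unit⁻¹ : Bbˣ) : Bb)
  have hyBi : yB * yBi = 1 := hyBu.mul_val_inv
  let wBb : V → Bb := Sum.elim (Sum.elim xB (fun _ => yB)) (fun _ => x0B)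
  have hev : ∀ p : MvPolynomial V A, algebraMap B Bb (Ideal.Quotient.mk 𝔟 p) = aeval wBb p := by
    intro p
    have h1 := MvPolynomial.aeval_unique
      ((IsScalarTower.toAlgHom A B Bb).comp (Ideal.Quotient.mkₐ A 𝔟))
    have hp := AlgHom.congr_fun h1 p
    have hfun : (⇑((IsScalarTower.toAlgHom A B Bb).comp (Ideal.Quotient.mkₐ A 𝔟)) ∘ X) = wBb := by
      funext x
      rcases x with (i | _) | _ <;> rfl
    rw [hfun] at hp
    exact hp
  have hrelB : ∀ f ∈ sK, aeval (Sum.elim xB (fun _ => yB)) (homog f f.totalDegree) = 0 := by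
    intro f hf
    have hmem : rel f ∈ 𝔟 := Ideal.subset_span (Set.mem_image_of_mem rel (Finset.mem_coe.mpr hf))
    have h0 : algebraMap B Bb (Ideal.Quotient.mk 𝔟 (rel f)) = 0 := by
      rw [Ideal.Quotient.eq_zero_iff_mem.mpr hmem, map_zero]
    rw [hev] at h0
    simp only [rel, map_mul, aeval_X, aeval_rename] at h0
    change x0B * aeval (Sum.elim xB (fun _ => yB)) (homog f f.totalDegree) = 0 at h0
    exact (hx0Bu.mul_right_eq_zero).mp h0
  let x' : Fin n → Bb := fun i => xB i * yBi
  have hx' : ∀ i, yB * x' i = xB i := fun i => by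
    simp only [x']
    rw [mul_left_comm, hyBi, mul_one]
  have hΨrel : ∀ f ∈ sK, aeval x' f = 0 := fun f hf => by
    have h := aeval_homog_smul f le_rfl x' yB
    have hfun : (Sum.elim (fun i => yB * x' i) (fun _ : Unit => yB) : Fin n ⊕ Unit → Bb) =
        Sum.elim xB (fun _ : Unit => yB) := by
      funext x
      rcases x with i | _
      · exact hx' i
      · rfl
    rw [hfun, hrelB f hf] at h
    exact ((hyBu.pow _).mul_right_eq_zero).mp h.symm
  have hΨker : ∀ p ∈ RingHom.ker π.toRingHom, aeval x' p = 0 := by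
    intro p hp
    rw [← hsK] at hp
    rw [← RingHom.mem_ker]
    refine (Ideal.span_le.mpr ?_) hp
    intro f hf
    exact hΨrel f hf
  let eC : (MvPolynomial (Fin n) A ⧸ RingHom.ker π.toRingHom) ≃ₐ[A] C :=
    Ideal.quotientKerAlgEquivOfSurjective hπ
  let ΨC : C →ₐ[A] Bb :=
    (Ideal.Quotient.liftₐ (RingHom.ker π.toRingHom) (aeval x') hΨker).comp (eC.symm : C →ₐ[A] _)
  have hΨC : ∀ p, ΨC (π p) = aeval x' p := fun p => by
    have he : eC.symm (π p) = Ideal.Quotient.mk _ p := by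
      rw [AlgEquiv.symm_apply_eq]
      rfl
    change Ideal.Quotient.liftₐ _ (aeval x') hΨker (eC.symm (π p)) = _
    rw [he]
    rfl
  let ΨP : P2 →ₐ[A] Bb := aevalTower ΨC (Sum.elim (fun _ => yB) (fun _ => x0B))
  have hΨPC : ∀ c, ΨP (MvPolynomial.C c) = ΨC c := fun c => aevalTower_C _ _ _
  have hΨPX : ∀ x, ΨP (X x) = Sum.elim (fun _ => yB) (fun _ => x0B) x := fun x => aevalTower_X _ _ _
  have hΨPt : ΨP tP = yB * x0B := by
    simp only [tP, map_mul, hΨPX, Sum.elim_inl, Sum.elim_inr]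
  have hΨPu : ∀ y : Submonoid.powers tP, IsUnit (ΨP y) := by
    rintro ⟨y, k, rfl⟩
    rw [map_pow, hΨPt]
    exact (hyBu.mul hx0Bu).pow k
  let Ψ : T →ₐ[A] Bb := IsLocalization.liftAlgHom hΨPu
  have hΨ : ∀ x : P2, Ψ (algebraMap P2 T x) = ΨP x := fun x => IsLocalization.lift_eq hΨPu x
  -- `Ψ ∘ Φ = id`
  have hΨΦ : Ψ.comp Φ = AlgHom.id A Bb := by
    apply AlgHom.coe_ringHom_injective
    refine IsLocalization.ringHom_ext (Submonoid.powers b) ?_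
    refine Ideal.Quotient.ringHom_ext ?_
    apply MvPolynomial.ringHom_ext
    · intro a
      change Ψ (Φ (algebraMap B Bb (Ideal.Quotient.mk 𝔟 (MvPolynomial.C a)))) =
        algebraMap B Bb (Ideal.Quotient.mk 𝔟 (MvPolynomial.C a))
      rw [hΦ, hΦ₁]
      simp only [Φ₀, aeval_C]
      rw [IsScalarTower.algebraMap_apply A P2 T, hΨ, IsScalarTower.algebraMap_apply A C P2,
        MvPolynomial.algebraMap_eq, hΨPC, ΨC.commutes]
      rfl
    · intro x
      change Ψ (Φ (algebraMap B Bb (Ideal.Quotient.mk 𝔟 (X x)))) =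
        algebraMap B Bb (Ideal.Quotient.mk 𝔟 (X x))
      rw [hΦ, hΦ₁]
      simp only [Φ₀, aeval_X]
      rcases x with (i | _) | _
      · change Ψ (yT * cT i) = xB i
        rw [map_mul]
        change Ψ (algebraMap P2 T (X (Sum.inl ()))) * Ψ (algebraMap C T (π (X i))) = xB i
        rw [hΨ, hΨPX, IsScalarTower.algebraMap_apply C P2 T, hΨ, MvPolynomial.algebraMap_eq, hΨPC,
          hΨC, aeval_X]
        exact hx' i
      · change Ψ yT = yB
        change Ψ (algebraMap P2 T (X (Sum.inl ()))) = yB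
        rw [hΨ, hΨPX]
        rfl
      · change Ψ x0T = x0B
        change Ψ (algebraMap P2 T (X (Sum.inr ()))) = x0B
        rw [hΨ, hΨPX]
        rfl
  -- conclusion: `B_b` is finitely presented and a retract of the smooth `T`
  haveI : Algebra.FinitePresentation R Bb := by
    haveI : Algebra.FinitePresentation B Bb := IsLocalization.Away.finitePresentation b
    exact Algebra.FinitePresentation.trans R B Bb
  haveI : Algebra.FormallySmooth R T := inferInstance
  have hfs : Algebra.FormallySmooth R Bb :=
    formallySmooth_of_retract (Φ.restrictScalars R) (Ψ.restrictScalars R) (by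
      apply AlgHom.ext
      intro x
      exact AlgHom.congr_fun hΨΦ x)
  exact ⟨hfs, inferInstance⟩

end Stacks07F9

/-! ## Stacks 07FA: resolving in dimension zero -/

section Stacks07FA

variable {R : Type u} [CommRing R] {A : Type u} [CommRing A] [Algebra R A]
  {Λ : Type u} [CommRing Λ] [Algebra R Λ]

/-- Smoothness of `B_b` from a retraction onto it of a smooth algebra. [folklore] -/
theorem smooth_away_of_retract {B : Type u} [CommRing B] [Algebra R B]
    [Algebra.FinitePresentation R B] (b : B) (T : Type u) [CommRing T] [Algebra R T]
    [Algebra.Smooth R T] (Φ : Localization.Away b →ₐ[R] T) (Ψ : T →ₐ[R] Localization.Away b)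
    (h : Ψ.comp Φ = AlgHom.id R _) : Algebra.Smooth R (Localization.Away b) :=
  haveI : Algebra.FinitePresentation B (Localization.Away b) :=
    IsLocalization.Away.finitePresentation b
  haveI : Algebra.FinitePresentation R (Localization.Away b) :=
    Algebra.FinitePresentation.trans R B _
  ⟨formallySmooth_of_retract Φ Ψ h, inferInstance⟩

/-- In a zero-dimensional localization `Λ_𝔮`, elements of `𝔮` are nilpotent up to an element
outside `𝔮`. [folklore] -/
theorem exists_mul_pow_eq_zero_of_krullDimLE_zero (q : Ideal Λ) [q.IsPrime]
    (hdim : Ring.KrullDimLE 0 (Localization.AtPrime q)) {x : Λ} (hx : x ∈ q) :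
    ∃ s ∉ q, ∃ N : ℕ, s * x ^ N = 0 := by
  have h3 := (Ring.krullDimLE_zero_and_isLocalRing_tfae
    (R := Localization.AtPrime q)).out 0 2
  have hnil : IsNilpotent (algebraMap Λ (Localization.AtPrime q) x) := by
    refine ((h3.mp ⟨hdim, inferInstance⟩) _).mpr ?_
    rw [← mem_nonunits_iff, ← IsLocalRing.mem_maximalIdeal]
    exact (IsLocalization.AtPrime.to_map_mem_maximal_iff _ q x).mpr hx
  obtain ⟨N, hN⟩ := hnil
  rw [← map_pow, IsLocalization.map_eq_zero_iff q.primeCompl] at hN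
  obtain ⟨⟨s, hs⟩, hsx⟩ := hN
  exact ⟨s, hs, N, hsx⟩

set_option maxHeartbeats 400000 in
/-- **Stacks, Lemma 07FA** (with Lemma 07F9 already applied): let `A → Λ ⊃ 𝔮` be as in
Situation 07F7 (`R` Noetherian, `A` finitely presented) with `𝔥_A ⊆ 𝔮` and `dim Λ_𝔮 = 0`,
and let `A → C → Λ` be a factorisation with `C` finitely presented and `H_{C/R}Λ ⊄ 𝔮`
(witnessed by `c ∈ C` with `C_c` smooth over `R` and `c ↦ Λ ∖ 𝔮`). Then `R → A → Λ ⊃ 𝔮` can be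
resolved. Printed proof: `𝔮Λ_𝔮` is nilpotent, so some `λ ∉ 𝔮` kills `(𝔥_A)^N`: `λ φ(a_i)^N = 0`
for generators `a_i` of `H_{A/R}`; with `C = A[x]/(f_1, …, f_m)` put
`B = A[x, y_i, z, t_{ij}]/(f_j - Σ y_i t_{ij}, z y_i)`, mapped to `Λ` through `C[y, z]/(yz)`
(`t_{ij} ↦ 0`, `z ↦ λ`, `y_i ↦ φ(a_i)^N`). Then `B_z ≅ C[t, z, z⁻¹]`, so `z·c ∈ √H_{B/R}`
for `c ∈ H_{C/R}`, and `B_{y_ℓ} ≅ A[x, y, y_ℓ⁻¹, t_{ij}, i ≠ ℓ]` is smooth over `A`, so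
`a_ℓ y_ℓ ∈ √H_{B/R}`; hence `𝔥_A ⊆ 𝔥_B ⊄ 𝔮`. (Here the two isomorphisms are replaced by
retractions `C_c[z, t, z⁻¹] → B_{z p_c}` and `A_{a_ℓ}[x, y, t, y_ℓ⁻¹] → B_{a_ℓ y_ℓ}`, which give
formal smoothness.) [cite: StacksProject, Tag 07FA] -/
theorem Stacks07FA_canResolve_of_factorization [IsNoetherianRing R]
    [Algebra.FinitePresentation R A] (φ : A →ₐ[R] Λ) (q : Ideal Λ) [q.IsPrime]
    (hq : hIdeal R φ ≤ q) (hdim : Ring.KrullDimLE 0 (Localization.AtPrime q))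
    (C : Type u) [CommRing C] [Algebra R C] [Algebra.FinitePresentation R C]
    (uC : A →ₐ[R] C) (vC : C →ₐ[R] Λ) (huv : ∀ a, vC (uC a) = φ a)
    (c : C) (hc : Algebra.Smooth R (Localization.Away c)) (hcq : vC c ∉ q) :
    CanResolve R φ q := by
  classical
  -- generators `sH` of `H_{A/R}` and the exponent `N`, the element `λ`
  haveI : IsNoetherianRing A := Algebra.FiniteType.isNoetherianRing R A
  obtain ⟨sH, hsH⟩ := (IsNoetherian.noetherian (singularIdeal R A))
  have hsHmem : ∀ a ∈ sH, a ∈ singularIdeal R A := fun a ha => hsH ▸ Ideal.subset_span ha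
  have hφq : ∀ a ∈ sH, φ a ∈ q := fun a ha =>
    hq (Ideal.le_radical (Ideal.mem_map_of_mem φ (hsHmem a ha)))
  have hkill : ∀ a ∈ sH, ∃ s ∉ q, ∃ N : ℕ, s * φ a ^ N = 0 := fun a ha =>
    exists_mul_pow_eq_zero_of_krullDimLE_zero q hdim (hφq a ha)
  choose! sq hsq Nq hNq using hkill
  let N : ℕ := ∑ a ∈ sH, Nq a
  have hNle : ∀ a ∈ sH, Nq a ≤ N := fun a ha => Finset.single_le_sum (fun _ _ => Nat.zero_le _) ha
  let lam : Λ := ∏ a ∈ sH, sq a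
  have hlam : lam ∈ q.primeCompl := prod_mem fun a ha => (hsq a ha : sq a ∈ q.primeCompl)
  have hlamkill : ∀ a ∈ sH, lam * φ a ^ N = 0 := fun a ha => by
    obtain ⟨rest, hrest⟩ : sq a ∣ lam := Finset.dvd_prod_of_mem _ ha
    rw [hrest, ← Nat.add_sub_cancel' (hNle a ha), pow_add, mul_assoc, mul_comm rest,
      mul_assoc, ← mul_assoc (sq a), hNq a ha, zero_mul]
  -- `C = A[x_1, …, x_n]/(f : f ∈ sF)` over `A`
  letI : Algebra A C := uC.toRingHom.toAlgebra
  haveI : IsScalarTower R A C := IsScalarTower.of_algebraMap_eq fun r => (uC.commutes r).symm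
  haveI : Algebra.FinitePresentation A C :=
    Algebra.FinitePresentation.of_restrict_scalars_finitePresentation R A C
  obtain ⟨n, π, hπ, hkfg⟩ := Algebra.FinitePresentation.out (R := A) (A := C)
  obtain ⟨sF, hsF⟩ := hkfg
  have hmemF : ∀ f ∈ sF, π f = 0 := fun f hf => by
    have : f ∈ RingHom.ker π.toRingHom := hsF ▸ Ideal.subset_span hf
    exact this
  obtain ⟨pc, hpc⟩ := hπ c
  -- `Λ` as an `A`-algebra; `vC` is `A`-linear
  letI : Algebra A Λ := φ.toRingHom.toAlgebra
  haveI : IsScalarTower R A Λ := IsScalarTower.of_algebraMap_eq fun r => (φ.commutes r).symm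
  let vA : C →ₐ[A] Λ := { toRingHom := vC.toRingHom, commutes' := huv }
  have hvA : ∀ x, vA x = vC x := fun x => rfl
  have haevalπ : (aeval fun k => vC (π (X k)) : MvPolynomial (Fin n) A →ₐ[A] Λ) = vA.comp π := by
    apply MvPolynomial.algHom_ext
    intro k
    rw [aeval_X, AlgHom.comp_apply, hvA]
  -- the variables: `x_k`, `y_i` (`i ∈ sH`), `z`, `t_{i,f}` (`f ∈ sF`)
  let I := ↥sH
  let J := ↥sF
  let V := ((Fin n ⊕ I) ⊕ Unit) ⊕ (I × J)
  let xv : Fin n → V := fun k => Sum.inl (Sum.inl (Sum.inl k))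
  let yv : I → V := fun i => Sum.inl (Sum.inl (Sum.inr i))
  let zv : V := Sum.inl (Sum.inr ())
  let tv : I × J → V := fun p => Sum.inr p
  let relF : J → MvPolynomial V A := fun f =>
    rename xv (f : MvPolynomial (Fin n) A) - ∑ i : I, X (yv i) * X (tv (i, f))
  let relZ : I → MvPolynomial V A := fun i => X zv * X (yv i)
  let 𝔟 : Ideal (MvPolynomial V A) := Ideal.span (Set.range (Sum.elim relF relZ))
  have h𝔟fg : 𝔟.FG := ⟨Finset.univ.image (Sum.elim relF relZ), by
    rw [Finset.coe_image, Finset.coe_univ, Set.image_univ]⟩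
  have hrelF : ∀ f : J, relF f ∈ 𝔟 := fun f => Ideal.subset_span ⟨Sum.inl f, rfl⟩
  have hrelZ : ∀ i : I, relZ i ∈ 𝔟 := fun i => Ideal.subset_span ⟨Sum.inr i, rfl⟩
  let B := MvPolynomial V A ⧸ 𝔟
  haveI : Algebra.FinitePresentation R (MvPolynomial V A) := .trans R A _
  haveI hB : Algebra.FinitePresentation R B := Algebra.FinitePresentation.quotient h𝔟fg
  -- a general principle for maps out of `A[V]` killing `𝔟`
  have hlift : ∀ {T : Type u} [CommRing T] [Algebra A T] (w : V → T),
      (∀ f : J, aeval (w ∘ xv) (f : MvPolynomial (Fin n) A) =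
        ∑ i : I, w (yv i) * w (tv (i, f))) →
      (∀ i : I, w zv * w (yv i) = 0) → ∀ x ∈ 𝔟, aeval w x = 0 := by
    intro T _ _ w hF hZ x hx
    rw [← RingHom.mem_ker]
    refine (Ideal.span_le.mpr ?_) hx
    rintro _ ⟨j, rfl⟩
    rw [SetLike.mem_coe, RingHom.mem_ker]
    rcases j with f | i
    · change aeval w (relF f) = 0
      simp only [relF, map_sub, map_sum, map_mul, aeval_X, aeval_rename]
      rw [hF f, sub_self]
    · change aeval w (relZ i) = 0
      simp only [relZ, map_mul, aeval_X]
      exact hZ i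
  -- `β : B → Λ`
  let wΛ : V → Λ := Sum.elim (Sum.elim (Sum.elim (fun k => vC (π (X k))) (fun i => φ (i : A) ^ N))
    (fun _ => lam)) (fun _ => 0)
  have hwΛx : (wΛ ∘ xv) = fun k => vC (π (X k)) := rfl
  have h𝔟Λ : ∀ x ∈ 𝔟, aeval wΛ x = 0 := by
    refine hlift wΛ (fun f => ?_) (fun i => ?_)
    · rw [hwΛx, haevalπ, AlgHom.comp_apply, hmemF f f.2, map_zero]
      exact (Finset.sum_eq_zero fun i _ => by
        change φ (i : A) ^ N * (0 : Λ) = 0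
        rw [mul_zero]).symm
    · change lam * φ (i : A) ^ N = 0
      exact hlamkill i i.2
  let βA : B →ₐ[A] Λ := Ideal.Quotient.liftₐ 𝔟 (aeval wΛ) h𝔟Λ
  have hβA : ∀ p, βA (Ideal.Quotient.mk 𝔟 p) = aeval wΛ p := fun p => rfl
  let β : B →ₐ[R] Λ := βA.restrictScalars R
  let α : A →ₐ[R] B := IsScalarTower.toAlgHom R A B
  have hβα : β.comp α = φ := by
    apply AlgHom.ext
    intro a
    change βA (algebraMap A B a) = φ a
    rw [βA.commutes]
    rfl
  -- the localisations: some general facts about `B_b`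
  have hev : ∀ (b : B) (p : MvPolynomial V A),
      algebraMap B (Localization.Away b) (Ideal.Quotient.mk 𝔟 p) =
        aeval (fun v => algebraMap B (Localization.Away b) (Ideal.Quotient.mk 𝔟 (X v))) p := by
    intro b p
    have h1 := MvPolynomial.aeval_unique
      ((IsScalarTower.toAlgHom A B (Localization.Away b)).comp (Ideal.Quotient.mkₐ A 𝔟))
    exact AlgHom.congr_fun h1 p
  have hrelFB : ∀ (b : B) (f : J),
      aeval (fun k => algebraMap B (Localization.Away b) (Ideal.Quotient.mk 𝔟 (X (xv k))))
        (f : MvPolynomial (Fin n) A) =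
      ∑ i : I, algebraMap B (Localization.Away b) (Ideal.Quotient.mk 𝔟 (X (yv i))) *
        algebraMap B (Localization.Away b) (Ideal.Quotient.mk 𝔟 (X (tv (i, f)))) := by
    intro b f
    have h0 : algebraMap B (Localization.Away b) (Ideal.Quotient.mk 𝔟 (relF f)) = 0 := by
      rw [Ideal.Quotient.eq_zero_iff_mem.mpr (hrelF f), map_zero]
    rw [hev] at h0
    simp only [relF, map_sub, map_sum, map_mul, aeval_X, aeval_rename] at h0
    exact sub_eq_zero.mp h0
  have hrelZB : ∀ (b : B) (i : I),
      algebraMap B (Localization.Away b) (Ideal.Quotient.mk 𝔟 (X zv)) *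
        algebraMap B (Localization.Away b) (Ideal.Quotient.mk 𝔟 (X (yv i))) = 0 := by
    intro b i
    rw [← map_mul, ← map_mul, show X zv * X (yv i) = relZ i from rfl,
      Ideal.Quotient.eq_zero_iff_mem.mpr (hrelZ i), map_zero]
  ------------------------------------------------------------------
  -- (1) `b₁ = z · p_c`: `B_{b₁}` is a retract of `C_c[z, t][1/z]`, and `β b₁ = λ v(c) ∉ 𝔮`
  ------------------------------------------------------------------
  let b₁ : B := Ideal.Quotient.mk 𝔟 (X zv * rename xv pc)
  have hβb₁ : β b₁ = lam * vC c := by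
    change βA (Ideal.Quotient.mk 𝔟 _) = _
    rw [hβA]
    simp only [map_mul, aeval_X, aeval_rename, hwΛx, haevalπ, AlgHom.comp_apply, hpc, hvA]
    rfl
  have hβb₁q : β b₁ ∉ q := by
    rw [hβb₁]
    exact q.primeCompl.mul_mem hlam hcq
  have hsmooth₁ : Algebra.Smooth R (Localization.Away b₁) := by
    let Bb := Localization.Away b₁
    let Cc := Localization.Away c
    haveI : Algebra.Smooth R Cc := hc
    let P1 := MvPolynomial (Unit ⊕ (I × J)) Cc
    let T := Localization.Away (X (Sum.inl ()) : P1)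
    haveI : Algebra.Smooth Cc P1 := ⟨inferInstance, inferInstance⟩
    haveI : Algebra.Smooth R P1 := Algebra.Smooth.comp R Cc P1
    haveI : Algebra.Smooth P1 T := Algebra.Smooth.of_isLocalization_Away (X (Sum.inl ()) : P1)
    haveI : Algebra.Smooth R T := Algebra.Smooth.comp R P1 T
    -- `Φ : B_{b₁} → T`
    let cT : Fin n → T := fun k => algebraMap C T (π (X k))
    let zT : T := algebraMap P1 T (X (Sum.inl ()))
    let tT : I × J → T := fun p => algebraMap P1 T (X (Sum.inr p))
    let wT : V → T := Sum.elim (Sum.elim (Sum.elim cT (fun _ => 0)) (fun _ => zT)) tT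
    have hwTx : (wT ∘ xv) = cT := rfl
    have haevalπT : (aeval cT : MvPolynomial (Fin n) A →ₐ[A] T) =
        (IsScalarTower.toAlgHom A C T).comp π := by
      apply MvPolynomial.algHom_ext
      intro k
      rw [aeval_X, AlgHom.comp_apply]
      rfl
    have h𝔟T : ∀ x ∈ 𝔟, aeval wT x = 0 := by
      refine hlift wT (fun f => ?_) (fun i => ?_)
      · rw [hwTx, haevalπT, AlgHom.comp_apply, hmemF f f.2, map_zero]
        exact (Finset.sum_eq_zero fun i _ => by
          change (0 : T) * tT (i, f) = 0
          rw [zero_mul]).symm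
      · change zT * 0 = 0
        rw [mul_zero]
    let Φ₁ : B →ₐ[A] T := Ideal.Quotient.liftₐ 𝔟 (aeval wT) h𝔟T
    have hΦ₁ : ∀ p, Φ₁ (Ideal.Quotient.mk 𝔟 p) = aeval wT p := fun p => rfl
    have hΦ₁b : Φ₁ b₁ = zT * algebraMap C T c := by
      change Φ₁ (Ideal.Quotient.mk 𝔟 _) = _
      rw [hΦ₁, map_mul, aeval_X, aeval_rename, hwTx, haevalπT, AlgHom.comp_apply, hpc]
      rfl
    have hzT : IsUnit zT := IsLocalization.Away.algebraMap_isUnit (X (Sum.inl ()) : P1)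
    have hcT : IsUnit (algebraMap C T c) := by
      rw [IsScalarTower.algebraMap_apply C Cc T]
      exact (IsLocalization.Away.algebraMap_isUnit c).map _
    have hΦ₁u : ∀ y : Submonoid.powers b₁, IsUnit (Φ₁ y) := by
      rintro ⟨y, k, rfl⟩
      rw [map_pow, hΦ₁b]
      exact (hzT.mul hcT).pow k
    let Φ : Bb →ₐ[A] T := IsLocalization.liftAlgHom hΦ₁u
    have hΦ : ∀ x : B, Φ (algebraMap B Bb x) = Φ₁ x := fun x => IsLocalization.lift_eq hΦ₁u x
    -- `Ψ : T → B_{b₁}`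
    let gB : V → Bb := fun v => algebraMap B Bb (Ideal.Quotient.mk 𝔟 (X v))
    have hbunit : IsUnit (algebraMap B Bb b₁) := IsLocalization.Away.algebraMap_isUnit b₁
    have hbB : algebraMap B Bb b₁ = gB zv * aeval (gB ∘ xv) pc := by
      change algebraMap B Bb (Ideal.Quotient.mk 𝔟 (X zv * rename xv pc)) = _
      rw [hev, map_mul, aeval_X, aeval_rename]
    have hzBu : IsUnit (gB zv) := isUnit_of_mul_isUnit_left (hbB ▸ hbunit)
    have hpcBu : IsUnit (aeval (gB ∘ xv) pc) := isUnit_of_mul_isUnit_right (hbB ▸ hbunit)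
    have hyB : ∀ i : I, gB (yv i) = 0 := fun i =>
      (hzBu.mul_right_eq_zero).mp (hrelZB b₁ i)
    have hkerπ : ∀ p ∈ RingHom.ker π.toRingHom, aeval (gB ∘ xv) p = 0 := by
      intro p hp
      rw [← hsF] at hp
      rw [← RingHom.mem_ker]
      refine (Ideal.span_le.mpr ?_) hp
      intro f hf
      rw [SetLike.mem_coe, RingHom.mem_ker]
      have := hrelFB b₁ ⟨f, hf⟩
      change aeval (fun k => algebraMap B Bb (Ideal.Quotient.mk 𝔟 (X (xv k))))
        ((⟨f, hf⟩ : J) : MvPolynomial (Fin n) A) = 0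
      rw [this]
      exact Finset.sum_eq_zero fun i _ => by
        change gB (yv i) * gB (tv (i, _)) = 0
        rw [hyB i, zero_mul]
    let eC : (MvPolynomial (Fin n) A ⧸ RingHom.ker π.toRingHom) ≃ₐ[A] C :=
      Ideal.quotientKerAlgEquivOfSurjective hπ
    let ΨC : C →ₐ[A] Bb :=
      (Ideal.Quotient.liftₐ (RingHom.ker π.toRingHom) (aeval (gB ∘ xv)) hkerπ).comp
        (eC.symm : C →ₐ[A] _)
    have hΨC : ∀ p, ΨC (π p) = aeval (gB ∘ xv) p := fun p => by
      have he : eC.symm (π p) = Ideal.Quotient.mk _ p := by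
        rw [AlgEquiv.symm_apply_eq]
        rfl
      change Ideal.Quotient.liftₐ _ (aeval (gB ∘ xv)) hkerπ (eC.symm (π p)) = _
      rw [he]
      rfl
    have hΨCc : ∀ y : Submonoid.powers c, IsUnit (ΨC y) := by
      rintro ⟨y, k, rfl⟩
      rw [map_pow, ← hpc, hΨC]
      exact hpcBu.pow k
    let ΨCc : Cc →ₐ[A] Bb := IsLocalization.liftAlgHom hΨCc
    have hΨCc : ∀ x : C, ΨCc (algebraMap C Cc x) = ΨC x := fun x => IsLocalization.lift_eq hΨCc x
    let ΨP : P1 →ₐ[A] Bb := aevalTower ΨCc (Sum.elim (fun _ => gB zv) (fun p => gB (tv p)))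
    have hΨPC : ∀ x, ΨP (MvPolynomial.C x) = ΨCc x := fun x => aevalTower_C _ _ _
    have hΨPX : ∀ x, ΨP (X x) = Sum.elim (fun _ => gB zv) (fun p => gB (tv p)) x := fun x =>
      aevalTower_X _ _ _
    have hΨPu : ∀ y : Submonoid.powers (X (Sum.inl ()) : P1), IsUnit (ΨP y) := by
      rintro ⟨y, k, rfl⟩
      rw [map_pow, hΨPX]
      exact hzBu.pow k
    let Ψ : T →ₐ[A] Bb := IsLocalization.liftAlgHom hΨPu
    have hΨ : ∀ x : P1, Ψ (algebraMap P1 T x) = ΨP x := fun x => IsLocalization.lift_eq hΨPu x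
    have hΨΦ : Ψ.comp Φ = AlgHom.id A Bb := by
      apply AlgHom.coe_ringHom_injective
      refine IsLocalization.ringHom_ext (Submonoid.powers b₁) ?_
      refine Ideal.Quotient.ringHom_ext ?_
      apply MvPolynomial.ringHom_ext
      · intro a
        change Ψ (Φ (algebraMap B Bb (Ideal.Quotient.mk 𝔟 (MvPolynomial.C a)))) =
          algebraMap B Bb (Ideal.Quotient.mk 𝔟 (MvPolynomial.C a))
        rw [hΦ, hΦ₁, aeval_C, IsScalarTower.algebraMap_apply A P1 T, hΨ,
          IsScalarTower.algebraMap_apply A Cc P1, MvPolynomial.algebraMap_eq, hΨPC,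
          ΨCc.commutes]
        rfl
      · intro x
        change Ψ (Φ (algebraMap B Bb (Ideal.Quotient.mk 𝔟 (X x)))) =
          algebraMap B Bb (Ideal.Quotient.mk 𝔟 (X x))
        rw [hΦ, hΦ₁, aeval_X]
        rcases x with ((k | i) | _) | p
        · change Ψ (algebraMap C T (π (X k))) = gB (xv k)
          rw [IsScalarTower.algebraMap_apply C Cc T, IsScalarTower.algebraMap_apply Cc P1 T, hΨ,
            MvPolynomial.algebraMap_eq, hΨPC, hΨCc, hΨC, aeval_X]
          rfl
        · change Ψ 0 = gB (yv i)
          rw [map_zero, hyB]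
        · change Ψ (algebraMap P1 T (X (Sum.inl ()))) = gB zv
          rw [hΨ, hΨPX]
          rfl
        · change Ψ (algebraMap P1 T (X (Sum.inr p))) = gB (tv p)
          rw [hΨ, hΨPX]
          rfl
    exact smooth_away_of_retract b₁ T (Φ.restrictScalars R) (Ψ.restrictScalars R) (by
      apply AlgHom.ext
      intro x
      exact AlgHom.congr_fun hΨΦ x)
  ------------------------------------------------------------------
  -- (2) `b₂ = a · y_a` for `a ∈ sH`: `B_{b₂}` is a retract of `A_a[x, y, t][1/y_a]`
  ------------------------------------------------------------------
  have hsmooth₂ : ∀ i : I, Algebra.Smooth R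
      (Localization.Away (Ideal.Quotient.mk 𝔟 (MvPolynomial.C (i : A) * X (yv i)) : B)) := by
    intro i₀
    let b₂ : B := Ideal.Quotient.mk 𝔟 (MvPolynomial.C (i₀ : A) * X (yv i₀))
    let Bb := Localization.Away b₂
    let Aa := Localization.Away (i₀ : A)
    haveI : Algebra.Smooth R Aa := mem_singularIdeal_iff_smooth.mp (hsHmem _ i₀.2)
    let P2 := MvPolynomial ((Fin n ⊕ I) ⊕ (I × J)) Aa
    let T := Localization.Away (X (Sum.inl (Sum.inr i₀)) : P2)
    haveI : Algebra.Smooth Aa P2 := ⟨inferInstance, inferInstance⟩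
    haveI : Algebra.Smooth R P2 := Algebra.Smooth.comp R Aa P2
    haveI : Algebra.Smooth P2 T := Algebra.Smooth.of_isLocalization_Away (X (Sum.inl (Sum.inr i₀)) : P2)
    haveI : Algebra.Smooth R T := Algebra.Smooth.comp R P2 T
    -- elements of `T`
    let xT : Fin n → T := fun k => algebraMap P2 T (X (Sum.inl (Sum.inl k)))
    let yT : I → T := fun i => algebraMap P2 T (X (Sum.inl (Sum.inr i)))
    let tT : I × J → T := fun p => algebraMap P2 T (X (Sum.inr p))
    have hyTu : IsUnit (yT i₀) := IsLocalization.Away.algebraMap_isUnit (X (Sum.inl (Sum.inr i₀)) : P2)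
    let yTi : T := ((hyTu.unit⁻¹ : Tˣ) : T)
    have hyTi : yT i₀ * yTi = 1 := hyTu.mul_val_inv
    -- `t_{i₀ f} ↦ (f(x) - Σ_{i ≠ i₀} y_i t_{i f}) / y_{i₀}`
    let solve : J → T := fun f =>
      (aeval xT (f : MvPolynomial (Fin n) A) -
        ∑ i ∈ Finset.univ.erase i₀, yT i * tT (i, f)) * yTi
    let tT' : I × J → T := fun p => if p.1 = i₀ then solve p.2 else tT p
    let wT : V → T := Sum.elim (Sum.elim (Sum.elim xT yT) (fun _ => 0)) tT'
    have hwTx : (wT ∘ xv) = xT := rfl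
    have h𝔟T : ∀ x ∈ 𝔟, aeval wT x = 0 := by
      refine hlift wT (fun f => ?_) (fun i => ?_)
      · rw [hwTx]
        change aeval xT (f : MvPolynomial (Fin n) A) = ∑ i : I, yT i * tT' (i, f)
        rw [← Finset.add_sum_erase _ _ (Finset.mem_univ i₀)]
        have h1 : tT' (i₀, f) = solve f := if_pos rfl
        have h2 : ∀ i ∈ Finset.univ.erase i₀, tT' (i, f) = tT (i, f) := fun i hi =>
          if_neg (Finset.ne_of_mem_erase hi)
        rw [h1, Finset.sum_congr rfl fun i hi => by rw [h2 i hi]]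
        simp only [solve]
        rw [mul_comm, mul_assoc, mul_comm yTi, hyTi, mul_one, sub_add_cancel]
      · change (0 : T) * yT i = 0
        rw [zero_mul]
    let Φ₁ : B →ₐ[A] T := Ideal.Quotient.liftₐ 𝔟 (aeval wT) h𝔟T
    have hΦ₁ : ∀ p, Φ₁ (Ideal.Quotient.mk 𝔟 p) = aeval wT p := fun p => rfl
    have hΦ₁b : Φ₁ b₂ = algebraMap A T (i₀ : A) * yT i₀ := by
      change Φ₁ (Ideal.Quotient.mk 𝔟 _) = _
      rw [hΦ₁, map_mul, aeval_C, aeval_X]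
      rfl
    have haT : IsUnit (algebraMap A T (i₀ : A)) := by
      rw [IsScalarTower.algebraMap_apply A Aa T]
      exact (IsLocalization.Away.algebraMap_isUnit (i₀ : A)).map _
    have hΦ₁u : ∀ y : Submonoid.powers b₂, IsUnit (Φ₁ y) := by
      rintro ⟨y, k, rfl⟩
      rw [map_pow, hΦ₁b]
      exact (haT.mul hyTu).pow k
    let Φ : Bb →ₐ[A] T := IsLocalization.liftAlgHom hΦ₁u
    have hΦ : ∀ x : B, Φ (algebraMap B Bb x) = Φ₁ x := fun x => IsLocalization.lift_eq hΦ₁u x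
    -- `Ψ : T → B_{b₂}`
    let gB : V → Bb := fun v => algebraMap B Bb (Ideal.Quotient.mk 𝔟 (X v))
    have hbunit : IsUnit (algebraMap B Bb b₂) := IsLocalization.Away.algebraMap_isUnit b₂
    have hbB : algebraMap B Bb b₂ = algebraMap A Bb (i₀ : A) * gB (yv i₀) := by
      change algebraMap B Bb (Ideal.Quotient.mk 𝔟 (MvPolynomial.C (i₀ : A) * X (yv i₀))) = _
      rw [hev, map_mul, aeval_C, aeval_X]
    have haBu : IsUnit (algebraMap A Bb (i₀ : A)) := isUnit_of_mul_isUnit_left (hbB ▸ hbunit)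
    have hyBu : IsUnit (gB (yv i₀)) := isUnit_of_mul_isUnit_right (hbB ▸ hbunit)
    have hzB : gB zv = 0 := (hyBu.mul_left_eq_zero).mp (hrelZB b₂ i₀)
    have haA : ∀ y : Submonoid.powers (i₀ : A), IsUnit (algebraMap A Bb y) := by
      rintro ⟨y, k, rfl⟩
      rw [map_pow]
      exact haBu.pow k
    let ΨA : Aa →ₐ[A] Bb := IsLocalization.liftAlgHom (M := Submonoid.powers (i₀ : A))
      (f := Algebra.ofId A Bb) haA
    let ΨP : P2 →ₐ[A] Bb := aevalTower ΨA
      (Sum.elim (Sum.elim (fun k => gB (xv k)) (fun i => gB (yv i))) (fun p => gB (tv p)))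
    have hΨPC : ∀ x, ΨP (MvPolynomial.C x) = ΨA x := fun x => aevalTower_C _ _ _
    have hΨPX : ∀ x, ΨP (X x) =
        Sum.elim (Sum.elim (fun k => gB (xv k)) (fun i => gB (yv i))) (fun p => gB (tv p)) x :=
      fun x => aevalTower_X _ _ _
    have hΨPu : ∀ y : Submonoid.powers (X (Sum.inl (Sum.inr i₀)) : P2), IsUnit (ΨP y) := by
      rintro ⟨y, k, rfl⟩
      rw [map_pow, hΨPX]
      exact hyBu.pow k
    let Ψ : T →ₐ[A] Bb := IsLocalization.liftAlgHom hΨPu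
    have hΨ : ∀ x : P2, Ψ (algebraMap P2 T x) = ΨP x := fun x => IsLocalization.lift_eq hΨPu x
    have hΨxT : ∀ k, Ψ (xT k) = gB (xv k) := fun k => by
      change Ψ (algebraMap P2 T (X _)) = _
      rw [hΨ, hΨPX]
      rfl
    have hΨyT : ∀ i, Ψ (yT i) = gB (yv i) := fun i => by
      change Ψ (algebraMap P2 T (X _)) = _
      rw [hΨ, hΨPX]
      rfl
    have hΨtT : ∀ p, Ψ (tT p) = gB (tv p) := fun p => by
      change Ψ (algebraMap P2 T (X _)) = _
      rw [hΨ, hΨPX]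
      rfl
    have hΨalg : ∀ a : A, Ψ (algebraMap A T a) = algebraMap A Bb a := fun a => Ψ.commutes a
    -- the solved variable goes back to `t_{i₀ f}`
    have hΨsolve : ∀ f : J, Ψ (solve f) = gB (tv (i₀, f)) := by
      intro f
      have hrel := hrelFB b₂ f
      -- in `B_{b₂}`: `f(x) = y_{i₀} t_{i₀ f} + Σ_{i ≠ i₀} y_i t_{i f}`
      rw [← Finset.add_sum_erase _ _ (Finset.mem_univ i₀)] at hrel
      have hΨaeval : Ψ (aeval xT (f : MvPolynomial (Fin n) A)) = aeval (gB ∘ xv) (f : MvPolynomial (Fin n) A) := by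
        rw [← AlgHom.comp_apply]  -- hmm: Ψ is A-linear: Ψ ∘ aeval xT = aeval (Ψ ∘ xT)
        have : (Ψ.comp (aeval xT) : MvPolynomial (Fin n) A →ₐ[A] Bb) = aeval (gB ∘ xv) := by
          apply MvPolynomial.algHom_ext
          intro k
          rw [AlgHom.comp_apply, aeval_X, aeval_X]
          exact hΨxT k
        rw [this]
      have hΨyTi : Ψ yTi * gB (yv i₀) = 1 := by
        rw [← hΨyT, ← map_mul, mul_comm, hyTi, map_one]
      simp only [solve, map_mul, map_sub, map_sum, hΨaeval, hΨyT, hΨtT]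
      change (aeval (fun k => gB (xv k)) (f : MvPolynomial (Fin n) A) - _) * Ψ yTi = _
      rw [hrel, add_sub_cancel_right, mul_comm (gB (yv i₀)), mul_assoc, mul_comm (gB (yv i₀)),
        hΨyTi, mul_one]
    have hΨΦ : Ψ.comp Φ = AlgHom.id A Bb := by
      apply AlgHom.coe_ringHom_injective
      refine IsLocalization.ringHom_ext (Submonoid.powers b₂) ?_
      refine Ideal.Quotient.ringHom_ext ?_
      apply MvPolynomial.ringHom_ext
      · intro a
        change Ψ (Φ (algebraMap B Bb (Ideal.Quotient.mk 𝔟 (MvPolynomial.C a)))) =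
          algebraMap B Bb (Ideal.Quotient.mk 𝔟 (MvPolynomial.C a))
        rw [hΦ, hΦ₁, aeval_C, hΨalg]
        rfl
      · intro x
        change Ψ (Φ (algebraMap B Bb (Ideal.Quotient.mk 𝔟 (X x)))) =
          algebraMap B Bb (Ideal.Quotient.mk 𝔟 (X x))
        rw [hΦ, hΦ₁, aeval_X]
        rcases x with ((k | i) | _) | ⟨i, f⟩
        · exact hΨxT k
        · exact hΨyT i
        · change Ψ 0 = gB zv
          rw [map_zero, hzB]
        · change Ψ (tT' (i, f)) = gB (tv (i, f))
          by_cases hi : i = i₀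
          · subst hi
            rw [show tT' (i, f) = solve f from if_pos rfl]
            exact hΨsolve f
          · rw [show tT' (i, f) = tT (i, f) from if_neg hi]
            exact hΨtT (i, f)
    exact smooth_away_of_retract b₂ T (Φ.restrictScalars R) (Ψ.restrictScalars R) (by
      apply AlgHom.ext
      intro x
      exact AlgHom.congr_fun hΨΦ x)
  ------------------------------------------------------------------
  -- conclusion: `𝔥_A ⊆ 𝔥_B ⊄ 𝔮`
  ------------------------------------------------------------------
  refine ⟨B, inferInstance, inferInstance, hB, α, β, hβα, ?_, ?_⟩
  · -- `𝔥_A ⊆ 𝔥_B`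
    change ((singularIdeal R A).map φ).radical ≤ ((singularIdeal R B).map β).radical
    rw [Ideal.radical_le_radical_iff, ← hsH, Ideal.map_span, Ideal.span_le]
    rintro _ ⟨a, ha, rfl⟩
    refine ⟨N + 1, ?_⟩
    have hb₂ : (Ideal.Quotient.mk 𝔟 (MvPolynomial.C a * X (yv ⟨a, ha⟩)) : B) ∈ singularIdeal R B :=
      mem_singularIdeal_iff_smooth.mpr (hsmooth₂ ⟨a, ha⟩)
    have himg : β (Ideal.Quotient.mk 𝔟 (MvPolynomial.C a * X (yv ⟨a, ha⟩))) = φ a ^ (N + 1) := by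
      change βA (Ideal.Quotient.mk 𝔟 _) = _
      rw [hβA, map_mul, aeval_C, aeval_X, pow_succ, mul_comm]
      rfl
    rw [← himg]
    exact Ideal.mem_map_of_mem β hb₂
  · -- `𝔥_B ⊄ 𝔮`
    intro hle
    have hb₁ : b₁ ∈ singularIdeal R B := mem_singularIdeal_iff_smooth.mpr hsmooth₁
    exact hβb₁q (hle (Ideal.le_radical (Ideal.mem_map_of_mem β hb₁)))

/-- **Stacks, Lemmas 07F9 + 07FA for a local base ring**: if `A → Λ → Λ_𝔮` factors through
a smooth `R`-algebra (`R = R_𝔭` local, or any base over which the local resolution is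
given), `𝔥_A ⊆ 𝔮` and `dim Λ_𝔮 = 0`, then `R → A → Λ ⊃ 𝔮` can be resolved.
[cite: StacksProject, Tag 07FA] -/
theorem canResolve_of_smooth_local_factorization_of_krullDimLE_zero [IsNoetherianRing R]
    [Algebra.FinitePresentation R A] (φ : A →ₐ[R] Λ) (q : Ideal Λ) [q.IsPrime]
    (hq : hIdeal R φ ≤ q) (hdim : Ring.KrullDimLE 0 (Localization.AtPrime q))
    (C : Type u) [CommRing C] [Algebra R C] [Algebra.Smooth R C]
    (u : A →ₐ[R] C) (v : C →ₐ[R] Localization.AtPrime q)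
    (huv : ∀ a, v (u a) = algebraMap Λ (Localization.AtPrime q) (φ a)) :
    CanResolve R φ q := by
  obtain ⟨B, _, _, hB, α, β, hβα, b, hbq, hsmooth⟩ :=
    Stacks07F9_local_exists_factorization φ q C u v huv
  haveI := hB
  exact Stacks07FA_canResolve_of_factorization φ q hq hdim B α β
    (fun a => AlgHom.congr_fun hβα a) b hsmooth hbq

end Stacks07FA

end Literature.AlgebraicGeometry.Resolution

end
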